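import Summits.CriticalPhenomena.PercolationContinuityZ3.Theorems.Transplant.SkelTubeLevels
import HarnessLib

/-!
# L5.1-Ω — Kozma–Nitzan Lemma 10 over a `PlanarSkeletonConc` in the HABITAT-RESTRICTED WINDOW GRAPH `winGraphIn G Ω`: the edges of `G`
# inside an arbitrary finite vertex set `Ω` (p1-g7's `winGraph G w₀ R` is the case `Ω = B_G(w₀, R)`), its planar levels
# `B⟨j⟩ = Ω ∩ φ⁻¹ Icc (lo − j) (hi + j)`, the level axioms, Step II, and the transfer of `Ω`-local probabilities — the generic layer the
# CORRIDOR residue (C) needs with `Ω := B_G(root, Rπ) ∩ Ucor` (SHEAR-SCOPE §2.6: with plain windows the (C) packaging is obstructed at the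
# cube's face row; with `Ω ⊆ Ucor` the containment "region ⊆ habitat" is definitional and `IsSubbox.outside` is a radius inequality)

builds on p205010 (kernel theorem, internal audit signed; external expert review pending) — nothing in this file uses p205010.
Status sentence (coordinator 2026-08-20T04:30Z): "θ(p_c) = 0 on ℤ^d, all d ≥ 2 — kernel-verified (Lean 4/Mathlib, standard axioms); internal
adversarial audit SIGNED 2026-08-20 04:29Z; external expert review pending."
Lane `prim-bschramm-*`, seat `prim-bschramm-p2` (gen 4); helper file (`--supports stmt-CriticalPhenomena-4575`).  Proofs are p1-g7's
(`SkelTubeLevels`, p231058) with `graphBall G w₀ R ↦ Ω`; `[DecidableEq V]` is a section binder from §2 on (p3-g4's ruling (3), 19:11:29Z).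

* §1 `winGraphIn G Ω`: adjacency, `winGraphIn_le`, local finiteness, `degree_winGraphIn_le(_Δ)`, `winGraphIn_mono`;
* §2 `PlanarSkeletonConc.WinIn Φ Ω P := Ω ∩ φ⁻¹ P`, levels `winLevelIn`, `mem_outerBoundary_winIn_iff` / `mem_innerBoundary_winIn_iff`,
  `winLevelIn_monotone`, **`winLevelIn_nest`** (outer boundary in `winGraphIn` of `B⟨j⟩` inside `B⟨j+1⟩`, by `lip`),
  `not_mem_innerBoundary_winIn_of_mem_Icc` (amendment (A));
* §3 `winLDataIn`, `lhyp_winIn` (the generic `KNLevels.LHyp`), **`stepII_winIn`** (degree bound `Φ.Δ`);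
* §4 `lattW_winGraphIn_eq`, `real_eq_of_determinedBy_winIn`.
[cite: KozmaNitzan2024, §4 Lemma 10, pp. 17–18 (Steps I–II), p. 15 (B⟨R⟩), p. 17 (subbox) — the ℤ^d model] [cite: GrimmettPercolation1999, §7.2]
-/

noncomputable section

open MeasureTheory ProbabilityTheory
open scoped ENNReal Classical

namespace Summit.CriticalPhenomena.PercolationContinuityZ3.Theorems

namespace Transplant

namespace Skel

open Literature.Probability.Percolation Literature.Probability.LatticeModels SimpleGraph
open KNLevels
open KozmaNitzan (wireSet_mono)

variable {V : Type} (G : SimpleGraph V)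

/-! ## §1 The window graph over a vertex set -/

/-- **The window graph over the vertex set `Ω`**: the edges of `G` both of whose endpoints lie in `Ω` (a subgraph on the same vertex
type; vertices off `Ω` are isolated).  `winGraph G w₀ R` is the case `Ω = B_G(w₀, R)`. [cite: KozmaNitzan2024, §4 p. 17 (subbox: the induced graph on D)] -/
def winGraphIn (Ω : Finset V) : SimpleGraph V where
  Adj u v := G.Adj u v ∧ u ∈ Ω ∧ v ∈ Ω
  symm := ⟨fun _ _ h => ⟨h.1.symm, h.2.2, h.2.1⟩⟩
  loopless := ⟨fun _ h => h.1.ne rfl⟩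

/-- Adjacency in the window graph over `Ω`. [folklore] -/
theorem winGraphIn_adj {Ω : Finset V} {u v : V} : (winGraphIn G Ω).Adj u v ↔ G.Adj u v ∧ u ∈ Ω ∧ v ∈ Ω := Iff.rfl

/-- The window graph is a subgraph of `G`. [folklore] -/
theorem winGraphIn_le (Ω : Finset V) : winGraphIn G Ω ≤ G := fun _ _ h => h.1

/-- Edges of the window graph are edges of `G`. [folklore] -/
theorem edgeSet_winGraphIn_subset (Ω : Finset V) : (winGraphIn G Ω).edgeSet ⊆ G.edgeSet :=
  SimpleGraph.edgeSet_mono (winGraphIn_le G Ω)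

/-- Inside `Ω` the window graph is `G`. [folklore] -/
theorem winGraphIn_adj_of_mem {Ω : Finset V} {u v : V} (hu : u ∈ Ω) (hv : v ∈ Ω) : (winGraphIn G Ω).Adj u v ↔ G.Adj u v :=
  ⟨fun h => h.1, fun h => ⟨h, hu, hv⟩⟩

/-- Vertices off `Ω` are isolated in the window graph. [folklore] -/
theorem not_winGraphIn_adj_of_not_mem {Ω : Finset V} {u : V} (hu : u ∉ Ω) (v : V) : ¬ (winGraphIn G Ω).Adj u v := fun h => hu h.2.1

/-- The window graphs grow with the vertex set. [folklore] -/
theorem winGraphIn_mono {Ω Ω' : Finset V} (h : Ω ⊆ Ω') : winGraphIn G Ω ≤ winGraphIn G Ω' :=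
  fun _ _ huv => ⟨huv.1, h huv.2.1, h huv.2.2⟩

variable [G.LocallyFinite]

/-- The window graph is locally finite. [folklore] -/
instance winGraphIn_locallyFinite (Ω : Finset V) : (winGraphIn G Ω).LocallyFinite := fun v =>
  Fintype.ofFinset ((G.neighborFinset v).filter fun w => v ∈ Ω ∧ w ∈ Ω) fun w => by
    simp only [Finset.mem_filter, SimpleGraph.mem_neighborFinset, SimpleGraph.mem_neighborSet, winGraphIn_adj]

/-- Degrees in the window graph are at most those in `G`. [folklore] -/
theorem degree_winGraphIn_le {Δ : ℕ} (hΔ : ∀ v, G.degree v ≤ Δ) (Ω : Finset V) (v : V) : (winGraphIn G Ω).degree v ≤ Δ :=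
  (SimpleGraph.degree_le_of_le (winGraphIn_le G Ω)).trans (hΔ v)

variable {G}

/-- With the degree bound (μ) of a `PlanarSkeletonConc`: window-graph degrees are `≤ Φ.Δ`. [folklore] -/
theorem degree_winGraphIn_le_Δ (Φ : PlanarSkeletonConc G) (Ω : Finset V) (v : V) : (winGraphIn G Ω).degree v ≤ Φ.Δ :=
  degree_winGraphIn_le G Φ.degree_le Ω v

end Skel

/-! ## §2 The planar windows and levels over `Ω` -/

namespace PlanarSkeletonConc

open Literature.Probability.Percolation Literature.Probability.LatticeModels SimpleGraph

variable {V : Type} {G : SimpleGraph V} [G.LocallyFinite] (Φ : PlanarSkeletonConc G)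

/-- **The window over the planar set `P` inside the vertex set `Ω`**: `Ω ∩ φ⁻¹ P` (`Φ.Win w₀ P R` is the case `Ω = B_G(w₀, R)`). [this work] -/
def WinIn (Ω : Finset V) (P : Finset (Site 2)) : Finset V := Ω.filter fun g => Φ.φ g ∈ P

/-- Membership in a window over `Ω`. [folklore] -/
theorem mem_WinIn {Ω : Finset V} {P : Finset (Site 2)} {g : V} : g ∈ Φ.WinIn Ω P ↔ g ∈ Ω ∧ Φ.φ g ∈ P := Finset.mem_filter

/-- Windows grow with the vertex set and the planar set. [folklore] -/
theorem WinIn_mono {Ω Ω' : Finset V} (hΩ : Ω ⊆ Ω') {P P' : Finset (Site 2)} (hP : P ⊆ P') : Φ.WinIn Ω P ⊆ Φ.WinIn Ω' P' := by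
  intro g hg
  rw [mem_WinIn] at hg ⊢
  exact ⟨hΩ hg.1, hP hg.2⟩

/-- Windows over `Ω` lie in `Ω`. [folklore] -/
theorem WinIn_subset (Ω : Finset V) (P : Finset (Site 2)) : Φ.WinIn Ω P ⊆ Ω := Finset.filter_subset _ _

end PlanarSkeletonConc

namespace Skel

open Literature.Probability.Percolation Literature.Probability.LatticeModels SimpleGraph
open KNLevels
open KozmaNitzan (wireSet_mono)

variable {V : Type} {G : SimpleGraph V} [G.LocallyFinite] (Φ : PlanarSkeletonConc G)

/-- **The window levels over `Ω`** `B⟨j⟩ := Ω ∩ φ⁻¹ Icc (lo - j) (hi + j)`. [cite: KozmaNitzan2024, §4 p. 15 (B⟨R⟩)] -/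
def winLevelIn (Ω : Finset V) (lo hi : Site 2) (j : ℕ) : Finset V := Φ.WinIn Ω (Finset.Icc (lo - (j : Site 2)) (hi + (j : Site 2)))

/-- Membership in a window level. [folklore] -/
theorem mem_winLevelIn_iff {Ω : Finset V} {lo hi : Site 2} {j : ℕ} {v : V} :
    v ∈ winLevelIn Φ Ω lo hi j ↔ v ∈ Ω ∧ Φ.φ v ∈ Finset.Icc (lo - (j : Site 2)) (hi + (j : Site 2)) := by
  rw [winLevelIn, Φ.mem_WinIn]

/-- Level `0` is the window over `Icc lo hi`. [folklore] -/
theorem winLevelIn_zero (Ω : Finset V) (lo hi : Site 2) : winLevelIn Φ Ω lo hi 0 = Φ.WinIn Ω (Finset.Icc lo hi) := by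
  simp [winLevelIn]

/-- Window levels lie in `Ω`. [folklore] -/
theorem winLevelIn_subset (Ω : Finset V) (lo hi : Site 2) (j : ℕ) : winLevelIn Φ Ω lo hi j ⊆ Ω := Φ.WinIn_subset Ω _

/-- **Level axiom 1**: the window levels increase. [folklore] -/
theorem winLevelIn_monotone (Ω : Finset V) (lo hi : Site 2) : Monotone (winLevelIn Φ Ω lo hi) := by
  intro j j' h
  refine Φ.WinIn_mono subset_rfl (Finset.Icc_subset_Icc (fun i => ?_) (fun i => ?_)) <;>
    simp only [Pi.sub_apply, Pi.add_apply, Pi.natCast_apply] <;> omega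

/-! ## §3 The level data, the hypotheses of Lemma 10, Step II over `Ω` -/

/-- **The level data in the window graph over `Ω`**: levels `winLevelIn Φ Ω lo hi`, source `o`, support `Sfin`.
[cite: KozmaNitzan2024, §4 Lemma 10 (p. 17)] -/
def winLDataIn (Ω : Finset V) (lo hi : Site 2) (o : V) (Sfin : Finset V) : LData (winGraphIn G Ω) :=
  ⟨winLevelIn Φ Ω lo hi, o, Sfin⟩

/-- The levels of `winLDataIn`. [folklore] -/
@[simp] theorem winLDataIn_X (Ω : Finset V) (lo hi : Site 2) (o : V) (Sfin : Finset V) :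
    (winLDataIn Φ Ω lo hi o Sfin).X = winLevelIn Φ Ω lo hi := rfl

/-- The source of `winLDataIn`. [folklore] -/
@[simp] theorem winLDataIn_o (Ω : Finset V) (lo hi : Site 2) (o : V) (Sfin : Finset V) : (winLDataIn Φ Ω lo hi o Sfin).o = o := rfl

/-- The support of `winLDataIn`. [folklore] -/
@[simp] theorem winLDataIn_Sfin (Ω : Finset V) (lo hi : Site 2) (o : V) (Sfin : Finset V) :
    (winLDataIn Φ Ω lo hi o Sfin).Sfin = Sfin := rfl

/-- `{o ↔ B}` for the window data over `Ω` is `{o ↔ WinIn Ω (Icc lo hi)}`. [folklore] -/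
theorem reachB_winLDataIn (Ω : Finset V) (lo hi : Site 2) (o : V) (Sfin : Finset V) :
    (winLDataIn Φ Ω lo hi o Sfin).reachB = ⋃ b ∈ Φ.WinIn Ω (Finset.Icc lo hi), openConn o b := by
  rw [LData.reachB, winLDataIn_X, winLevelIn_zero]; rfl

variable [DecidableEq V]

/-- **Outer boundary of a window in the window graph over `Ω`**: `x ∈ ∂^{out} WinIn Ω P` iff `x ∈ Ω`, `φ x ∉ P`, and `x` has a
`G`-neighbour in `Ω` with skeleton coordinate in `P`. [cite: KozmaNitzan2024, §4 p. 15 (∂_ev B)] -/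
theorem mem_outerBoundary_winIn_iff {Ω : Finset V} {P : Finset (Site 2)} {x : V} :
    x ∈ outerBoundary (winGraphIn G Ω) (Φ.WinIn Ω P) ↔ x ∈ Ω ∧ Φ.φ x ∉ P ∧ ∃ y, G.Adj x y ∧ y ∈ Ω ∧ Φ.φ y ∈ P := by
  rw [mem_outerBoundary_iff]
  constructor
  · rintro ⟨hx, y, hy, hxy⟩
    rw [Φ.mem_WinIn] at hy
    obtain ⟨hadj, hx1, hy1⟩ := (winGraphIn_adj G).1 hxy
    exact ⟨hx1, fun h => hx ((Φ.mem_WinIn).2 ⟨hx1, h⟩), y, hadj, hy1, hy.2⟩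
  · rintro ⟨hx1, hxP, y, hxy, hy1, hyP⟩
    exact ⟨fun h => hxP ((Φ.mem_WinIn).1 h).2, y, (Φ.mem_WinIn).2 ⟨hy1, hyP⟩, (winGraphIn_adj G).2 ⟨hxy, hx1, hy1⟩⟩

/-- **Inner boundary of a window in the window graph over `Ω`**: `v ∈ ∂^{in} WinIn Ω P` iff `v ∈ WinIn Ω P` and `v` has a `G`-neighbour
in `Ω` whose skeleton coordinate is outside `P`. [cite: KozmaNitzan2024, §4 p. 17 (∂_iv D)] -/
theorem mem_innerBoundary_winIn_iff {Ω : Finset V} {P : Finset (Site 2)} {v : V} :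
    v ∈ innerBoundary (winGraphIn G Ω) (Φ.WinIn Ω P) ↔ (v ∈ Ω ∧ Φ.φ v ∈ P) ∧ ∃ y, G.Adj v y ∧ y ∈ Ω ∧ Φ.φ y ∉ P := by
  rw [mem_innerBoundary_iff, Φ.mem_WinIn]
  constructor
  · rintro ⟨hv, y, hy, hvy⟩
    obtain ⟨hadj, -, hy1⟩ := (winGraphIn_adj G).1 hvy
    exact ⟨hv, y, hadj, hy1, fun h => hy ((Φ.mem_WinIn).2 ⟨hy1, h⟩)⟩
  · rintro ⟨hv, y, hvy, hy1, hyP⟩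
    exact ⟨hv, y, fun h => hyP ((Φ.mem_WinIn).1 h).2, (winGraphIn_adj G).2 ⟨hvy, hv.1, hy1⟩⟩

/-- **Level axiom 2**: the outer boundary (in the window graph over `Ω`) of `B⟨j⟩` lies in `B⟨j+1⟩` — by the Lipschitz step.
[cite: KozmaNitzan2024, §4 p. 15 (∂_ev B ⊆ B⟨1⟩)] -/
theorem winLevelIn_nest (Ω : Finset V) (lo hi : Site 2) (j : ℕ) :
    outerBoundary (winGraphIn G Ω) (winLevelIn Φ Ω lo hi j) ⊆ winLevelIn Φ Ω lo hi (j + 1) := by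
  intro x hx
  obtain ⟨hx1, -, y, hxy, -, hyP⟩ := (mem_outerBoundary_winIn_iff Φ).1 hx
  rw [mem_winLevelIn_iff]
  refine ⟨hx1, ?_⟩
  have h := φ_mem_Icc_enlarge_of_adj Φ hyP hxy.symm
  refine Finset.Icc_subset_Icc (fun i => ?_) (fun i => ?_) h <;>
    simp only [Pi.sub_apply, Pi.add_apply, Pi.natCast_apply, Pi.one_apply] <;> push_cast <;> omega

/-- A contact vertex of level `j` (outer boundary in the window graph over `Ω`) lies in the planar ANNULUS `B⟨j+1⟩ ∖ B⟨j⟩`. [folklore] -/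
theorem mem_sdiff_of_mem_outerBoundary_winLevelIn {Ω : Finset V} {lo hi : Site 2} {j : ℕ} {x : V}
    (hx : x ∈ outerBoundary (winGraphIn G Ω) (winLevelIn Φ Ω lo hi j)) :
    x ∈ winLevelIn Φ Ω lo hi (j + 1) \ winLevelIn Φ Ω lo hi j :=
  Finset.mem_sdiff.2 ⟨winLevelIn_nest Φ Ω lo hi j hx, (mem_outerBoundary_iff.1 hx).1⟩

/-- **Amendment (A)**: a window vertex whose skeleton coordinate lies in the SHRUNK box `Icc (lo + 1) (hi - 1)` is not an inner-boundary
vertex of `WinIn Ω (Icc lo hi)` in the window graph over `Ω`. [cite: KozmaNitzan2024, §4 p. 17 (∂_iv D)] -/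
theorem not_mem_innerBoundary_winIn_of_mem_Icc {Ω : Finset V} {lo hi : Site 2} {v : V}
    (hv : Φ.φ v ∈ Finset.Icc (lo + 1) (hi - 1)) : v ∉ innerBoundary (winGraphIn G Ω) (Φ.WinIn Ω (Finset.Icc lo hi)) := by
  intro h
  obtain ⟨-, y, hvy, -, hyP⟩ := (mem_innerBoundary_winIn_iff Φ).1 h
  refine hyP ?_
  have h1 := φ_mem_Icc_enlarge_of_adj Φ hv hvy
  refine Finset.Icc_subset_Icc (fun i => ?_) (fun i => ?_) h1 <;>
    simp only [Pi.sub_apply, Pi.add_apply, Pi.one_apply] <;> omega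

/-- **The hypotheses of Lemma 10 for window levels over `Ω`**: a subbox `D ⊇ B⟨Rl+1⟩` (in `winGraphIn G Ω`) of a finitely supported
weighting at parameter `p` and a source `o ∈ Sfin \ D` give `KNLevels.LHyp`. [cite: KozmaNitzan2024, §4 Lemma 10 (p. 17)] -/
theorem lhyp_winIn (Ω : Finset V) (lo hi : Site 2) {o : V} {Sfin D : Finset V} {Wt : Sym2 V → unitInterval} {p : unitInterval}
    {Rl : ℕ} (hsub : IsSubbox (winGraphIn G Ω) Wt p D) (hfin : FinSupp Wt Sfin) (hDS : D ⊆ Sfin)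
    (hencl : winLevelIn Φ Ω lo hi (Rl + 1) ⊆ D) (ho : o ∉ D) (hoS : o ∈ Sfin) :
    LHyp (winLDataIn Φ Ω lo hi o Sfin) Wt p D Rl where
  mono := winLevelIn_monotone Φ Ω lo hi
  nest := winLevelIn_nest Φ Ω lo hi
  sub := hsub
  fin := hfin
  DS := hDS
  encl := hencl
  o_not := ho
  o_mem := hoS

/-- **Kozma–Nitzan's Step II over the window levels over `Ω`** (degrees `≤ Φ.Δ`): generic twin of `stepII_win` with `B_G(w₀, R) ↦ Ω`.
[cite: KozmaNitzan2024, §4 p. 18 (Step II)] -/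
theorem stepII_winIn [Countable V] (Ω : Finset V) (lo hi : Site 2) {o : V} {Sfin D : Finset V}
    {Wt : Sym2 V → unitInterval} {p : unitInterval} {Rl : ℕ}
    (hsub : IsSubbox (winGraphIn G Ω) Wt p D) (hfin : FinSupp Wt Sfin) (hDS : D ⊆ Sfin)
    (hencl : winLevelIn Φ Ω lo hi (Rl + 1) ⊆ D) (ho : o ∉ D) (hoS : o ∈ Sfin)
    (hp1 : (p : ℝ) < 1) {N j₀ j₁ : ℕ} (hj₁ : j₁ ≤ Rl) {δ : ℝ}
    (hJ : 1 / (1 - (p : ℝ)) ^ (Φ.Δ * N) ≤ δ * ((Finset.Icc j₀ j₁).card : ℝ))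
    (hreach : 1 - δ < (prodBernoulli Wt).real (⋃ b ∈ Φ.WinIn Ω (Finset.Icc lo hi), openConn o b)) :
    ∃ j ∈ Finset.Icc j₀ j₁, 1 - 2 * δ < (prodBernoulli Wt).real {ω | N ≤ ((winLDataIn Φ Ω lo hi o Sfin).Kont j ω).card} := by
  have hL := lhyp_winIn Φ Ω lo hi hsub hfin hDS hencl ho hoS
  rw [← reachB_winLDataIn Φ Ω lo hi o Sfin] at hreach
  exact hL.stepII (degree_winGraphIn_le_Δ Φ Ω) hp1 hj₁ hJ hreach

/-! ## §4 Transfer of `Ω`-local probabilities between the window graph and `G` -/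

omit [DecidableEq V] [G.LocallyFinite] in
/-- On the off-diagonal pairs inside `Ω` the graph weightings of the window graph and of `G` agree. [folklore] -/
theorem lattW_winGraphIn_eq {Ω : Finset V} (p : unitInterval) {e : Sym2 V} (he : e ∈ wireSet (↑Ω : Set V)) :
    lattW (winGraphIn G Ω) p e = lattW G p e := by
  induction e using Sym2.ind with
  | h u v =>
    obtain ⟨hu, hv, -⟩ := mk_mem_wireSet_iff.1 he
    by_cases h : G.Adj u v
    · rw [lattW_mk_of_adj _ p h, lattW_mk_of_adj _ p ((winGraphIn_adj G).2 ⟨h, Finset.mem_coe.1 hu, Finset.mem_coe.1 hv⟩)]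
    · rw [lattW_mk_of_not_adj _ p h, lattW_mk_of_not_adj _ p (fun h' => h ((winGraphIn_adj G).1 h').1)]

omit [DecidableEq V] [G.LocallyFinite] in
/-- **Transfer**: an event determined by the pairs inside `Ω` has the same probability under bond percolation on the window graph over
`Ω` and on `G`. [cite: KozmaNitzan2024, §4 p. 17 ("the induced graph on D is isomorphic to …")] -/
theorem real_eq_of_determinedBy_winIn {Ω : Finset V} (p : unitInterval) {A : Set (BondConfig V)}
    (hA : DeterminedBy A (wireSet (↑Ω : Set V))) (hAm : MeasurableSet A) :
    (bondPercolation (winGraphIn G Ω) p).real A = (bondPercolation G p).real A := by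
  rw [← prodBernoulli_lattW, ← prodBernoulli_lattW]
  exact prodBernoulli_real_eq_of_determinedBy _ _ (fun e he => lattW_winGraphIn_eq p he) hA hAm

end Skel

end Transplant

end Summit.CriticalPhenomena.PercolationContinuityZ3.Theorems

end
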